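/-
Copyright (c) 2026 the pub-hodgecm-mathlib formalisation cell (harness21).  Prover seat hodgecm-mathlib-F0P3a-p01 (g33), req620 Track A «(D-RAM) FOUR-FRAME» squad, unit U2H:
the (ρ2b′-X) child (U2H ED. 15 :418) — organ O-Lit brick 2, file (ε) «SOCKET A: THE OPPOSITE-SIGN LITERAL `ta ∈ G_v` OF A TYPE-(2) `γ_H` AT A WILD PLACE» (payer LH4-p14 (g4)
`SOCKET-hLitA.v1` 8d423671 minus its two tame-only anisotropy clauses and the integrality clause, my 05:17Z «S3 ≠»; MAP v1 seam S3).  2026-09-04.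
-/
import Summits.HodgeConjecture.HodgeConjecture.Theorems.F0P3cDyRamTypeTwoAnisotropicLiteralWild   -- (δ) `exists_anisotropicLiteral_wild_of_partner`; brings (γ), ★ brick 1 p857204, ★ datum files
import Summits.HodgeConjecture.HodgeConjecture.Theorems.F0P3cDyRamEigenFieldPackageTypeTwo         -- ★ T3-E head p857432 `exists_eigenPackage`, `not_isSquare_of_rootless`
import Summits.HodgeConjecture.HodgeConjecture.Theorems.F0P3cDyRamEllipticPlaneLineModel           -- ★ T3-E part 1 p857255 `exists_lineModel`
import Summits.HodgeConjecture.HodgeConjecture.Theorems.F0P3cDyRamPartnerPlane                     -- ★ (α) p857468 `exists_partnerPlane`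
import Summits.HodgeConjecture.HodgeConjecture.Theorems.F0P3cDyRamPartnerTwistScalar               -- ★ (β) p857496 `exists_twistScalar`
import Literature.NumberTheory.Rogawski1990.UnitFundamentalLemmaFrameOfFormCongr                   -- ★ p846897: the one-place frame `e`, clause (iii) matching ⟺ conjugacy
import Literature.NumberTheory.NumberFields.RamifiedQuadraticDictionaryWild                        -- ★ `exists_isSquare_inv_mul_coe_of_ne_zero` (a global representative of the disc class)
import Literature.NumberTheory.Rogawski1990.TwoDeepRepresentativesTypeTwoLocal                     -- ★ `stdForm_antidiagonal_two_over_eq`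
import Literature.NumberTheory.Automorphic.UnitaryLatticeTreeApartment                             -- ★ `pairing_mulVec_mulVec_of_mem_unitary`
import Literature.NumberTheory.Rogawski1990.TypeTwoRamifiedOppositeLiteral                         -- ★ tame sibling: `mul_self_map_eq_one_of_oneByOne_unitary`, `stdForm_antidiagonal_one_over_eq`
import HarnessLib

/-!
# Crux `H413`, line LH4 «(D-RAM) FOUR-FRAME» road — unit U2H, (ρ2b′-X), organ O-Lit brick 2, file (ε): SOCKET A — THE OPPOSITE-SIGN LITERAL `ta` AT A WILD PLACE

Cell `hodgecm-mathlib` (D-0151), FLOOR 0, crux item H413 = `stmt-HodgeConjecture-24833`, route of record `HCCMUnconditional`; squad F0∕P3c∕LH4; registered stub served: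
`F0P3cDyRamFourFrameU2H.stub_U2H_fixedPointCensus_typeTwo_unit0` ((ρ2b′-X), U2H ED. 15 :418) through RHO2BX-ORDER v1's head-of-organs in hypothesis form
(LH4-p14 (g4) `F0P3cDyRamFixedPointCensusTypeTwoOfOrgans.hOrgNV_at_of_organs (hLitA) (hCensus)`): THIS FILE IS `hLitA`'s supplier.  THEOREMS ONLY (no `def`, no instance, no
notation, no `sorry`); lane `--supports stmt-HodgeConjecture-24833 --as helper` (count-neutral).

WHAT THIS FILE DOES.  At a ramified non-split CM place `w ∣ v` with datum `(σ_w, ϖ, d, t_E)` (ANY residue characteristic), for EVERY `G`-regular TYPE-(2) `γ_H = (γ₂, u) ∈ H_v`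
(`χ_{γ₂,w}` rootless): there is a match `ta ∈ G_v = U(Φ₃)(L⁺_v)` of `γ_H` in the class of `κ`-sign `−1`, TOGETHER WITH ITS BLOCK LETTERS — `ι_w(ta) = P₁·endoGL(γ₁, u_w)·P₁⁻¹`,
`ᵗσ_w(P₁)·Φ₃·P₁ = diag(dg₀, dg₁) ⊥ (η)` with `σ`-fixed UNITS `dg₀, dg₁, η`, `η` NOT a norm from `L_w`, `γ₁ ∈ U(σ_w, diag dg)` with the characteristic polynomial of `γ₂,w` — the
letters of LH4-p14 (g4)'s `SOCKET-hLitA.v1` minus (≠1) its two unit-level anisotropy clauses (tame-only: false at wild `w`, e.g. `diag(1, −3)` over `ℚ₂(i)`) and (≠2) the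
integrality of `γ₁` (a census fact about level-`0` order lattices on the anisotropic side, to be supplied from the T5(−) heads if the payer's fibration wants it).
Assembly (`exists_oppositeLiteral_wild`): the line model of `(Φ₂, γ₂)` (★ T3-E head p857432 `exists_eigenPackage` on a global representative ★ `exists_isSquare_inv_mul_coe_of_ne_zero`
of the discriminant class, ★ part 1 p857255 `exists_lineModel`, ★ `map_h_eq_h_of_hermitian`) ⟶ the twist scalar `n₀` with non-norm norm (★ (β) p857496) ⟶ the partner plane `Ψ₀`
(★ (α) p857468: `γ₂ ∈ U(Ψ₀)`, `det Ψ₀ = det Φ₂·N(n₀)`) ⟶ the wild literal `Y ∈ U(σ_w, J₀)` with its block letters ((δ) `exists_anisotropicLiteral_wild_of_partner`) ⟶ pull-back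
`ta := e⁻¹(Y)` along the one-place frame at `A = 1` (★ p846897 clause (iii): matched) ⟶ `κ_v(γ_H, ta) = −(1, θ)_v = −1` (★ brick 1 p857204
`finKappaAt_eq_neg_hilbertSymbol_of_nonNorm_length_anyPlace` at `y_λ = 1`, the `u`-eigenvector `P₁e₁` having the NON-NORM length `η`).
Helpers: `unitary_two_det_trace` (a `σ`-unitary `2 × 2` block has `D·σD = 1`, `t = D·σt`), `diagTwo_eq_diagonal`.
HONEST LABEL.  Count-neutral helper; (ρ2b′-X) stays an OPEN prover target; `HC_CM` is proved only modulo the 7 printed citations (2 remaining named inputs: hLiu418 =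
`stmt-HodgeConjecture-24832`, h413 = `stmt-HodgeConjecture-24833`) until rung 0 closes.

## References
* [Rogawski1990] J. D. Rogawski, *Automorphic Representations of Unitary Groups in Three Variables*, Ann. of Math. Stud. 123 (1990), §3.5 Prop. 3.5.2 (c) p. 26, §3.6 p. 31,
  §4.8 Case (a) p. 53, §4.9 Prop. 4.9.1 p. 55, Lemma 4.9.3 p. 56.
* [LabesseLanglands1979] J.-P. Labesse, R. P. Langlands, *L-indistinguishability for SL(2)*, Canad. J. Math. 31 (1979), §2 pp. 8–10.
* [LanglandsShelstad1987] R. P. Langlands, D. Shelstad, *On the definition of transfer factors*, Math. Ann. 278 (1987), §1.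
-/

set_option autoImplicit false

noncomputable section

open NumberField IsDedekindDomain Matrix Polynomial
open Literature.NumberTheory.Automorphic Literature.NumberTheory.Automorphic.UnitaryGroup Literature.NumberTheory.Automorphic.UnitaryLatticeTree
open Literature.NumberTheory.Rogawski1990 Literature.NumberTheory.QuadraticForms Literature.NumberTheory.NumberFields
open scoped MatrixGroups ValuativeRel Topology

namespace Summit.HodgeConjecture.HodgeConjecture.Cruxes.H413.F0P3cDyRamTypeTwoOppositeLiteralWild

/-! ## §1 Helpers -/

/-- A `σ`-unitary `2 × 2` block for `Φ₂ = antidiag(1,1)` has `det·σ(det) = 1` and `tr = det·σ(tr)`. [cite: Rogawski1990, §3.6 p. 31] -/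
theorem unitary_two_det_trace {K : Type} [Field K] (σ : K →+* K) {g : GL (Fin 2) K}
    (hg : g ∈ unitaryGroupOfForm σ !![(0 : K), 1; 1, 0]) :
    (g : Matrix (Fin 2) (Fin 2) K).det * σ (g : Matrix (Fin 2) (Fin 2) K).det = 1 ∧
      ((g : Matrix (Fin 2) (Fin 2) K) 0 0 + (g : Matrix (Fin 2) (Fin 2) K) 1 1) =
        (g : Matrix (Fin 2) (Fin 2) K).det * σ ((g : Matrix (Fin 2) (Fin 2) K) 0 0 + (g : Matrix (Fin 2) (Fin 2) K) 1 1) := by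
  rw [mem_unitaryGroupOfForm_iff] at hg
  have h := fun i j => congr_fun (congr_fun hg i) j
  have e00 := h 0 0; have e01 := h 0 1; have e10 := h 1 0; have e11 := h 1 1
  simp [Matrix.mul_apply, Fin.sum_univ_two] at e00 e01 e10 e11
  set a := (g : Matrix (Fin 2) (Fin 2) K) 0 0
  set b := (g : Matrix (Fin 2) (Fin 2) K) 0 1
  set c := (g : Matrix (Fin 2) (Fin 2) K) 1 0
  set d := (g : Matrix (Fin 2) (Fin 2) K) 1 1
  constructor
  · rw [Matrix.det_fin_two, map_sub, map_mul, map_mul]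
    linear_combination (σ b * c + σ d * a) * e01 + e10 - (σ b * d + σ d * b) * e00
  · rw [Matrix.det_fin_two, map_add]
    linear_combination (-a) * e01 + (-d) * e10 + b * e00 + c * e11

/-- `!![a, 0; 0, b] = diagonal ![a, b]`. [cite: Rogawski1990, §3.6 p. 31] -/
theorem diagTwo_eq_diagonal {K : Type} [Field K] (a b : K) : !![a, 0; 0, b] = Matrix.diagonal ![a, b] := by
  ext i j; fin_cases i <;> fin_cases j <;> simp

/-! ## §2 From an eigen-field package to the wild literal (abstract eigen-field `M`) -/

section Core

variable (L : Type) [Field L] [NumberField L] [IsCMField L] {v : HeightOneSpectrum (𝓞 ↥(maximalRealSubfield L))}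
  (w : PlacesOver L v) (hw : IsCMField.complexConj L • w.1 = w.1)

include hw in
/-- **THE WILD LITERAL FROM AN EIGEN-FIELD PACKAGE** (★ part 1 ∘ ★ (β) ∘ ★ (α) ∘ (δ), over an ABSTRACT eigen-field `M` — the completed global model is plugged in by
`exists_oppositeLiteral_wild`).  Inputs: the datum, `g ∈ U(Φ₂)` with trace `t`, determinant `D`, rootless `X² − tX + D`, `D·σD = 1`, `t = D·σt`, `t² ≠ 4D`; `u` with `σu·u = 1`;
the package `(jE, ρ, Θ, λ)` with `ρ ∘ jE = jE`, `Θ ∘ jE = jE ∘ σ_w`, `ρρ = ΘΘ = id`, `Θρ = ρΘ`, `Fix ρ = jE`, a `ρ`-moved `α`, `λ² = tλ − D`, `ρλ = t − λ`, `Θλ·λ = 1`, unique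
coordinates.  Output: the conclusion of (δ) `exists_anisotropicLiteral_wild_of_partner`. [cite: Rogawski1990, §4.9 Prop. 4.9.1 p. 55; §3.5 Prop. 3.5.2 (c) p. 26]
[cite: LabesseLanglands1979, §2 pp. 8–10] -/
theorem exists_literalData_of_package (he : v.asIdeal.ramificationIdx' w.1.asIdeal ≠ 1) {ϖ : w.1.adicCompletion L} {d tE : ℕ}
    (hD : Literature.NumberTheory.Automorphic.UnitaryThreeFourFrame.IsRamifiedQuadraticDatum (galAdicCompletionMap (L := L) (IsCMField.complexConj L) hw) ϖ d tE)
    (g : GL (Fin 2) (w.1.adicCompletion L)) (hgU : g ∈ unitaryGroupOfForm (galAdicCompletionMap (L := L) (IsCMField.complexConj L) hw) !![(0 : w.1.adicCompletion L), 1; 1, 0])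
    {t D : w.1.adicCompletion L} (htr : (g : Matrix (Fin 2) (Fin 2) (w.1.adicCompletion L)) 0 0 + (g : Matrix (Fin 2) (Fin 2) (w.1.adicCompletion L)) 1 1 = t)
    (hdet : (g : Matrix (Fin 2) (Fin 2) (w.1.adicCompletion L)) 0 0 * (g : Matrix (Fin 2) (Fin 2) (w.1.adicCompletion L)) 1 1 -
      (g : Matrix (Fin 2) (Fin 2) (w.1.adicCompletion L)) 0 1 * (g : Matrix (Fin 2) (Fin 2) (w.1.adicCompletion L)) 1 0 = D)
    (hD0 : D ≠ 0) (hΔ : t * t - 4 * D ≠ 0) (hirr : ∀ x : w.1.adicCompletion L, x * x - t * x + D ≠ 0)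
    (hDσ : D * galAdicCompletionMap (L := L) (IsCMField.complexConj L) hw D = 1)
    (uu : GL (Fin 1) (w.1.adicCompletion L))
    (hu1 : galAdicCompletionMap (L := L) (IsCMField.complexConj L) hw ((uu : Matrix (Fin 1) (Fin 1) (w.1.adicCompletion L)) 0 0) * ((uu : Matrix (Fin 1) (Fin 1) (w.1.adicCompletion L)) 0 0) = 1)
    {M : Type} [Field M] (jE : w.1.adicCompletion L →+* M) (ρ Θ : M →+* M)
    (hρj : ∀ a, ρ (jE a) = jE a) (hΘj : ∀ a, Θ (jE a) = jE (galAdicCompletionMap (L := L) (IsCMField.complexConj L) hw a))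
    (hρρ : ∀ z, ρ (ρ z) = z) (hΘΘ : ∀ z, Θ (Θ z) = z) (hΘρ : ∀ z, Θ (ρ z) = ρ (Θ z)) (hjfix : ∀ z, ρ z = z ↔ ∃ a, jE a = z)
    {α : M} (hα : ρ α ≠ α)
    {lam : M} (hlam : lam * lam = jE t * lam - jE D) (hρlam : ρ lam = jE t - lam) (hΘlam : Θ lam * lam = 1)
    (hcoord : ∀ z : M, ∃! pq : w.1.adicCompletion L × w.1.adicCompletion L, z = jE pq.1 + jE pq.2 * lam) :
    ∃ (P : GL (Fin 3) (w.1.adicCompletion L)) (C : GL (Fin 2) (w.1.adicCompletion L)) (d₀ d₁ a₁ : w.1.adicCompletion L),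
      P ∈ glInt 3 (w.1.adicCompletion L) ∧
      galAdicCompletionMap (L := L) (IsCMField.complexConj L) hw d₀ = d₀ ∧ galAdicCompletionMap (L := L) (IsCMField.complexConj L) hw d₁ = d₁ ∧
      Valued.v d₀ = 1 ∧ Valued.v d₁ = 1 ∧
      C⁻¹ * g * C ∈ unitaryGroupOfForm (galAdicCompletionMap (L := L) (IsCMField.complexConj L) hw) !![d₀, 0; 0, d₁] ∧
      galAdicCompletionMap (L := L) (IsCMField.complexConj L) hw a₁ = a₁ ∧ Valued.v a₁ = 1 ∧
      (¬ ∃ t : w.1.adicCompletion L, t * galAdicCompletionMap (L := L) (IsCMField.complexConj L) hw t = a₁) ∧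
      formCongr (galAdicCompletionMap (L := L) (IsCMField.complexConj L) hw) P ((StdForm.antidiagonal 3).over (w.1.adicCompletion L)) = endoForm !![d₀, 0; 0, d₁] !![a₁] ∧
      P * endoGL (C⁻¹ * g * C, uu) * P⁻¹ ∈ unitaryGroupOfForm (galAdicCompletionMap (L := L) (IsCMField.complexConj L) hw) ((StdForm.antidiagonal 3).over (w.1.adicCompletion L)) ∧
      IsConj (endoGL (g, uu)) (P * endoGL (C⁻¹ * g * C, uu) * P⁻¹) ∧
      ((P * endoGL (C⁻¹ * g * C, uu) * P⁻¹ : GL (Fin 3) (w.1.adicCompletion L)) : Matrix (Fin 3) (Fin 3) (w.1.adicCompletion L)).mulVec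
          (fun k => (P : Matrix (Fin 3) (Fin 3) (w.1.adicCompletion L)) k 1) =
        ((uu : Matrix (Fin 1) (Fin 1) (w.1.adicCompletion L)) 0 0) • (fun k => (P : Matrix (Fin 3) (Fin 3) (w.1.adicCompletion L)) k 1) ∧
      (fun k => (P : Matrix (Fin 3) (Fin 3) (w.1.adicCompletion L)) k 1) ≠ 0 ∧
      (∑ i : Fin 3, ∑ k : Fin 3, galAdicCompletionMap (L := L) (IsCMField.complexConj L) hw ((P : Matrix (Fin 3) (Fin 3) (w.1.adicCompletion L)) i 1) *
          (StdForm.antidiagonal 3).over (w.1.adicCompletion L) i k * (P : Matrix (Fin 3) (Fin 3) (w.1.adicCompletion L)) k 1) = a₁ := by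
  have hσσ : ∀ x, (galAdicCompletionMap (L := L) (IsCMField.complexConj L) hw) ((galAdicCompletionMap (L := L) (IsCMField.complexConj L) hw) x) = x := hD.1
  -- ★ part 1: the line model of `(Φ₂, g)`
  have hU : ∀ x y, pairing (galAdicCompletionMap (L := L) (IsCMField.complexConj L) hw) !![(0 : w.1.adicCompletion L), 1; 1, 0] ((g : Matrix (Fin 2) (Fin 2) (w.1.adicCompletion L)).mulVec x)
      ((g : Matrix (Fin 2) (Fin 2) (w.1.adicCompletion L)).mulVec y) = pairing (galAdicCompletionMap (L := L) (IsCMField.complexConj L) hw) !![(0 : w.1.adicCompletion L), 1; 1, 0] x y :=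
    fun x y => pairing_mulVec_mulVec_of_mem_unitary hgU x y
  obtain ⟨φ, h, hφs, -, hφo, hφγ, hform⟩ :=
    F0P3cDyRamEllipticPlaneLineModel.exists_lineModel (galAdicCompletionMap (L := L) (IsCMField.complexConj L) hw) !![(0 : w.1.adicCompletion L), 1; 1, 0] jE ρ Θ hρj hΘj hD0 hΔ hlam hρlam hΘlam hcoord g htr hdet hirr hU
  have hΦh : ∀ a b : Fin 2, (galAdicCompletionMap (L := L) (IsCMField.complexConj L) hw) ((!![(0 : w.1.adicCompletion L), 1; 1, 0]) a b) = (!![(0 : w.1.adicCompletion L), 1; 1, 0]) b a := by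
    intro a b; fin_cases a <;> fin_cases b <;> simp
  have hΘh : Θ h = h :=
    Literature.NumberTheory.Automorphic.EllipticPlaneAsFieldLine.map_h_eq_h_of_hermitian (galAdicCompletionMap (L := L) (IsCMField.complexConj L) hw) hσσ hΦh jE hΘΘ hΘρ hΘj hα φ hφo hform
  -- ★ (β): the twist scalar; ★ (α): the partner plane
  obtain ⟨n₀, a₀, hΘn, -, ha0, hνn, hsym⟩ :=
    F0P3cDyRamPartnerTwistScalar.exists_twistScalar L w hw jE ρ Θ hρj hΘj hρρ hΘρ hjfix hDσ hΔ hlam hρlam hΘlam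
  obtain ⟨Ψ₀, hΨ₀h, hΨ₀U, -, hΨ₀det⟩ :=
    F0P3cDyRamPartnerPlane.exists_partnerPlane (galAdicCompletionMap (L := L) (IsCMField.complexConj L) hw) !![(0 : w.1.adicCompletion L), 1; 1, 0] jE ρ Θ hρj hΘj hρρ hΘΘ hΘρ hjfix φ hφs hφγ hΘlam hΘh hform hΘn
  have hdetΨ₀ : Ψ₀.det = (!![(0 : w.1.adicCompletion L), 1; 1, 0]).det * toPlace v w a₀ := by
    apply jE.injective
    rw [hΨ₀det, map_mul, ← hνn]; ring
  have hν : (galAdicCompletionMap (L := L) (IsCMField.complexConj L) hw) (toPlace v w a₀) = toPlace v w a₀ := galAdicCompletionMap_toPlace (IsCMField.complexConj L) w w hw a₀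
  have hνN : ¬ ∃ z : w.1.adicCompletion L, (galAdicCompletionMap (L := L) (IsCMField.complexConj L) hw) z * z = toPlace v w a₀ := (hilbertSymbol_eq_neg_one_iff_not_exists_norm_toPlace L v w hw ha0).1 hsym
  have hgΨ₀ : g ∈ unitaryGroupOfForm (galAdicCompletionMap (L := L) (IsCMField.complexConj L) hw) Ψ₀ := F0P3cDyRamTypeTwoAnisotropicLiteralWild.mem_unitaryGroupOfForm_of_pairing (galAdicCompletionMap (L := L) (IsCMField.complexConj L) hw) Ψ₀ g hΨ₀U
  -- (δ): the wild literal and its block letters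
  exact F0P3cDyRamTypeTwoAnisotropicLiteralWild.exists_anisotropicLiteral_wild_of_partner L w hw he hD g hΨ₀h hgΨ₀ hν hνN hdetΨ₀ uu hu1

end Core

/-! ## §3 Socket A: the opposite-sign literal at a wild place -/

section CM

variable (L : Type) [Field L] [NumberField L] [IsCMField L] {v : HeightOneSpectrum (𝓞 ↥(maximalRealSubfield L))}
  (w : PlacesOver L v) (hw : IsCMField.complexConj L • w.1 = w.1)

include hw in
/-- **STEP A — the literal data of `γ_H`**: for a type-(2) `γ_H` at a wild place, the conclusion of (δ) at `g := ι_w γ_H.1`, `u := ι_w γ_H.2` (global model of the eigen-field built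
here: ★ `exists_isSquare_inv_mul_coe_of_ne_zero`, `AdjoinRoot (X² − m)`, ★ T3-E head p857432; then §2). [cite: Rogawski1990, §4.9 Lemma 4.9.3 p. 56; Prop. 4.9.1 p. 55] -/
theorem exists_literalData (he : v.asIdeal.ramificationIdx' w.1.asIdeal ≠ 1) {ϖ : w.1.adicCompletion L} {d tE : ℕ}
    (hD : Literature.NumberTheory.Automorphic.UnitaryThreeFourFrame.IsRamifiedQuadraticDatum (galAdicCompletionMap (L := L) (IsCMField.complexConj L) hw) ϖ d tE)
    (γH : ((UnitaryGroup.cmDatum L 2 (Matrix.of fun i j : Fin 2 => if i.val + j.val + 1 = 2 then (1 : L) else 0)).Local v × (UnitaryGroup.cmDatum L 1 (Matrix.of fun i j : Fin 1 => if i.val + j.val + 1 = 1 then (1 : L) else 0)).Local v))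
    (hirr : ¬ (∃ x : (w.1.adicCompletion L), (((((γH).1.val : GL (Fin 2) (UnitaryGroup.LocalRing L v)).val.map (Pi.evalRingHom (fun w' : UnitaryGroup.PlacesOver L v => w'.1.adicCompletion L) w))).charpoly).IsRoot x)) :
    ∃ (P : GL (Fin 3) (w.1.adicCompletion L)) (C : GL (Fin 2) (w.1.adicCompletion L)) (d₀ d₁ a₁ : (w.1.adicCompletion L)),
      P ∈ glInt 3 (w.1.adicCompletion L) ∧
      (galAdicCompletionMap (L := L) (IsCMField.complexConj L) hw) d₀ = d₀ ∧ (galAdicCompletionMap (L := L) (IsCMField.complexConj L) hw) d₁ = d₁ ∧ Valued.v d₀ = 1 ∧ Valued.v d₁ = 1 ∧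
      C⁻¹ * ((localNonsplitEquiv (IsCMField.complexConj L) (Matrix.of fun i j : Fin 2 => if i.val + j.val + 1 = 2 then (1 : L) else 0) (IsCMField.complexConj_ne_one L) w hw γH.1).val : GL (Fin 2) (w.1.adicCompletion L)) * C ∈ unitaryGroupOfForm (galAdicCompletionMap (L := L) (IsCMField.complexConj L) hw) !![d₀, 0; 0, d₁] ∧
      (galAdicCompletionMap (L := L) (IsCMField.complexConj L) hw) a₁ = a₁ ∧ Valued.v a₁ = 1 ∧ (¬ ∃ t : (w.1.adicCompletion L), t * (galAdicCompletionMap (L := L) (IsCMField.complexConj L) hw) t = a₁) ∧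
      formCongr (galAdicCompletionMap (L := L) (IsCMField.complexConj L) hw) P ((StdForm.antidiagonal 3).over (w.1.adicCompletion L)) = endoForm !![d₀, 0; 0, d₁] !![a₁] ∧
      P * endoGL (C⁻¹ * ((localNonsplitEquiv (IsCMField.complexConj L) (Matrix.of fun i j : Fin 2 => if i.val + j.val + 1 = 2 then (1 : L) else 0) (IsCMField.complexConj_ne_one L) w hw γH.1).val : GL (Fin 2) (w.1.adicCompletion L)) * C, ((localNonsplitEquiv (IsCMField.complexConj L) (Matrix.of fun i j : Fin 1 => if i.val + j.val + 1 = 1 then (1 : L) else 0) (IsCMField.complexConj_ne_one L) w hw γH.2).val : GL (Fin 1) (w.1.adicCompletion L))) * P⁻¹ ∈ unitaryGroupOfForm (galAdicCompletionMap (L := L) (IsCMField.complexConj L) hw) ((StdForm.antidiagonal 3).over (w.1.adicCompletion L)) ∧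
      IsConj (endoGL (((localNonsplitEquiv (IsCMField.complexConj L) (Matrix.of fun i j : Fin 2 => if i.val + j.val + 1 = 2 then (1 : L) else 0) (IsCMField.complexConj_ne_one L) w hw γH.1).val : GL (Fin 2) (w.1.adicCompletion L)), ((localNonsplitEquiv (IsCMField.complexConj L) (Matrix.of fun i j : Fin 1 => if i.val + j.val + 1 = 1 then (1 : L) else 0) (IsCMField.complexConj_ne_one L) w hw γH.2).val : GL (Fin 1) (w.1.adicCompletion L)))) (P * endoGL (C⁻¹ * ((localNonsplitEquiv (IsCMField.complexConj L) (Matrix.of fun i j : Fin 2 => if i.val + j.val + 1 = 2 then (1 : L) else 0) (IsCMField.complexConj_ne_one L) w hw γH.1).val : GL (Fin 2) (w.1.adicCompletion L)) * C, ((localNonsplitEquiv (IsCMField.complexConj L) (Matrix.of fun i j : Fin 1 => if i.val + j.val + 1 = 1 then (1 : L) else 0) (IsCMField.complexConj_ne_one L) w hw γH.2).val : GL (Fin 1) (w.1.adicCompletion L))) * P⁻¹) ∧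
      ((P * endoGL (C⁻¹ * ((localNonsplitEquiv (IsCMField.complexConj L) (Matrix.of fun i j : Fin 2 => if i.val + j.val + 1 = 2 then (1 : L) else 0) (IsCMField.complexConj_ne_one L) w hw γH.1).val : GL (Fin 2) (w.1.adicCompletion L)) * C, ((localNonsplitEquiv (IsCMField.complexConj L) (Matrix.of fun i j : Fin 1 => if i.val + j.val + 1 = 1 then (1 : L) else 0) (IsCMField.complexConj_ne_one L) w hw γH.2).val : GL (Fin 1) (w.1.adicCompletion L))) * P⁻¹ : GL (Fin 3) (w.1.adicCompletion L)) : Matrix (Fin 3) (Fin 3) (w.1.adicCompletion L)).mulVec (fun k => (P : Matrix (Fin 3) (Fin 3) (w.1.adicCompletion L)) k 1) =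
        ((((localNonsplitEquiv (IsCMField.complexConj L) (Matrix.of fun i j : Fin 1 => if i.val + j.val + 1 = 1 then (1 : L) else 0) (IsCMField.complexConj_ne_one L) w hw γH.2).val : GL (Fin 1) (w.1.adicCompletion L)) : Matrix (Fin 1) (Fin 1) (w.1.adicCompletion L)) 0 0) • (fun k => (P : Matrix (Fin 3) (Fin 3) (w.1.adicCompletion L)) k 1) ∧
      (fun k => (P : Matrix (Fin 3) (Fin 3) (w.1.adicCompletion L)) k 1) ≠ 0 ∧
      (∑ i : Fin 3, ∑ k : Fin 3, (galAdicCompletionMap (L := L) (IsCMField.complexConj L) hw) ((P : Matrix (Fin 3) (Fin 3) (w.1.adicCompletion L)) i 1) * (StdForm.antidiagonal 3).over (w.1.adicCompletion L) i k * (P : Matrix (Fin 3) (Fin 3) (w.1.adicCompletion L)) k 1) = a₁ := by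
  classical
  have hc1 : IsCMField.complexConj L ≠ 1 := IsCMField.complexConj_ne_one L
  haveI : Algebra.IsQuadraticExtension ↥(maximalRealSubfield L) L := IsCMField.isQuadraticExtension L
  haveI : CharZero (w.1.adicCompletion L) := charZero_of_injective_algebraMap (algebraMap L (w.1.adicCompletion L)).injective
  have hσσ : ∀ x, (galAdicCompletionMap (L := L) (IsCMField.complexConj L) hw) ((galAdicCompletionMap (L := L) (IsCMField.complexConj L) hw) x) = x := hD.1
  have hvσ : ∀ x, Valued.v ((galAdicCompletionMap (L := L) (IsCMField.complexConj L) hw) x) = Valued.v x := hD.2.1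
  have h2 : (2 : w.1.adicCompletion L) ≠ 0 := two_ne_zero
  set g : GL (Fin 2) (w.1.adicCompletion L) := ((localNonsplitEquiv (IsCMField.complexConj L) (Matrix.of fun i j : Fin 2 => if i.val + j.val + 1 = 2 then (1 : L) else 0) (IsCMField.complexConj_ne_one L) w hw γH.1).val : GL (Fin 2) (w.1.adicCompletion L)) with hgdef
  set uu : GL (Fin 1) (w.1.adicCompletion L) := ((localNonsplitEquiv (IsCMField.complexConj L) (Matrix.of fun i j : Fin 1 => if i.val + j.val + 1 = 1 then (1 : L) else 0) (IsCMField.complexConj_ne_one L) w hw γH.2).val : GL (Fin 1) (w.1.adicCompletion L)) with huudef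
  have hg' : (g : Matrix (Fin 2) (Fin 2) (w.1.adicCompletion L)) =
      ((γH.1.val : GL (Fin 2) (UnitaryGroup.LocalRing L v)).val.map (Pi.evalRingHom (fun w' : PlacesOver L v => w'.1.adicCompletion L) w)) := rfl
  have hgU : g ∈ unitaryGroupOfForm (galAdicCompletionMap (L := L) (IsCMField.complexConj L) hw) !![(0 : w.1.adicCompletion L), 1; 1, 0] := by
    have h : ((g : Matrix (Fin 2) (Fin 2) (w.1.adicCompletion L)).map (galAdicCompletionMap (L := L) (IsCMField.complexConj L) hw))ᵀ *
        placeForm (Matrix.of fun i j : Fin 2 => if i.val + j.val + 1 = 2 then (1 : L) else 0) w.1 * (g : Matrix (Fin 2) (Fin 2) (w.1.adicCompletion L)) = placeForm (Matrix.of fun i j : Fin 2 => if i.val + j.val + 1 = 2 then (1 : L) else 0) w.1 :=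
      mem_unitaryGroupOfForm_iff.1 (localNonsplitEquiv (IsCMField.complexConj L) (Matrix.of fun i j : Fin 2 => if i.val + j.val + 1 = 2 then (1 : L) else 0) hc1 w hw γH.1).2
    rw [placeForm_antidiagOne, stdForm_antidiagonal_two_over_eq] at h
    exact mem_unitaryGroupOfForm_iff.2 h
  have hu1 : (galAdicCompletionMap (L := L) (IsCMField.complexConj L) hw) ((uu : Matrix (Fin 1) (Fin 1) (w.1.adicCompletion L)) 0 0) * (uu : Matrix (Fin 1) (Fin 1) (w.1.adicCompletion L)) 0 0 = 1 := by
    have h : ((uu : Matrix (Fin 1) (Fin 1) (w.1.adicCompletion L)).map (galAdicCompletionMap (L := L) (IsCMField.complexConj L) hw))ᵀ *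
        placeForm (Matrix.of fun i j : Fin 1 => if i.val + j.val + 1 = 1 then (1 : L) else 0) w.1 * (uu : Matrix (Fin 1) (Fin 1) (w.1.adicCompletion L)) = placeForm (Matrix.of fun i j : Fin 1 => if i.val + j.val + 1 = 1 then (1 : L) else 0) w.1 :=
      mem_unitaryGroupOfForm_iff.1 (localNonsplitEquiv (IsCMField.complexConj L) (Matrix.of fun i j : Fin 1 => if i.val + j.val + 1 = 1 then (1 : L) else 0) hc1 w hw γH.2).2
    rw [placeForm_antidiagOne, stdForm_antidiagonal_one_over_eq] at h
    have hmat : (uu : Matrix (Fin 1) (Fin 1) (w.1.adicCompletion L)) = !![(uu : Matrix (Fin 1) (Fin 1) (w.1.adicCompletion L)) 0 0] := by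
      ext i j; fin_cases i; fin_cases j; rfl
    rw [hmat] at h
    exact mul_self_map_eq_one_of_oneByOne_unitary (galAdicCompletionMap (L := L) (IsCMField.complexConj L) hw) h
  -- trace, determinant, discriminant of `g`
  set t : w.1.adicCompletion L := (g : Matrix (Fin 2) (Fin 2) (w.1.adicCompletion L)) 0 0 + (g : Matrix (Fin 2) (Fin 2) (w.1.adicCompletion L)) 1 1 with htdef
  set D : w.1.adicCompletion L := (g : Matrix (Fin 2) (Fin 2) (w.1.adicCompletion L)).det with hDdef
  obtain ⟨hDσ, htσ⟩ := unitary_two_det_trace (galAdicCompletionMap (L := L) (IsCMField.complexConj L) hw) hgU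
  rw [← hDdef] at hDσ htσ
  rw [← htdef] at htσ
  have hD0 : D ≠ 0 := fun h0 => by rw [h0, zero_mul] at hDσ; exact zero_ne_one hDσ
  have hirr' : ∀ x : w.1.adicCompletion L, x * x - t * x + D ≠ 0 := by
    intro x hx
    apply hirr
    refine ⟨x, ?_⟩
    rw [← hg', Polynomial.IsRoot, Matrix.charpoly_fin_two, Matrix.trace_fin_two]
    simp only [eval_add, eval_sub, eval_pow, eval_X, eval_mul, eval_C]
    rw [← hx]; ring
  have hΔ : t * t - 4 * D ≠ 0 := by
    intro h0
    apply hirr' (2⁻¹ * t)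
    have : (2⁻¹ * t) * (2⁻¹ * t) - t * (2⁻¹ * t) + D = -(4⁻¹) * (t * t - 4 * D) := by field_simp; ring
    rw [this, h0, mul_zero]
  -- a global representative `m ∈ L` of the discriminant class: `t² − 4D = s²·m`
  obtain ⟨m, hm0, r, hr⟩ := exists_isSquare_inv_mul_coe_of_ne_zero w.1 hΔ
  have hr0 : r ≠ 0 := by
    intro h0; rw [h0, mul_zero, mul_eq_zero] at hr
    rcases hr with h | h
    · exact inv_ne_zero hΔ h
    · exact hm0 ((map_eq_zero _).1 h)
  set s : w.1.adicCompletion L := r⁻¹ with hsdef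
  have hs0 : s ≠ 0 := inv_ne_zero hr0
  have hΔsm : t * t - 4 * D = s * s * (m : w.1.adicCompletion L) := by
    have h1 : (m : w.1.adicCompletion L) = (t * t - 4 * D) * (r * r) := by
      rw [← hr, ← mul_assoc, mul_inv_cancel₀ hΔ, one_mul]; rfl
    rw [h1, hsdef]; field_simp
  have hns : ¬ IsSquare (m : w.1.adicCompletion L) := F0P3cDyRamEigenFieldPackageTypeTwo.not_isSquare_of_rootless h2 hΔsm hirr'
  have htr : (g : Matrix (Fin 2) (Fin 2) (w.1.adicCompletion L)) 0 0 + (g : Matrix (Fin 2) (Fin 2) (w.1.adicCompletion L)) 1 1 = t := rfl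
  have hdet : (g : Matrix (Fin 2) (Fin 2) (w.1.adicCompletion L)) 0 0 * (g : Matrix (Fin 2) (Fin 2) (w.1.adicCompletion L)) 1 1 -
      (g : Matrix (Fin 2) (Fin 2) (w.1.adicCompletion L)) 0 1 * (g : Matrix (Fin 2) (Fin 2) (w.1.adicCompletion L)) 1 0 = D := (Matrix.det_fin_two _).symm
  have hnsL : ¬ IsSquare m := not_isSquare_of_not_isSquare_algebraMap m hns
  -- the global model `E′ = L(√m)` and the eigen-field package (★ T3-E)
  haveI : Fact (Irreducible (X ^ 2 - Polynomial.C m)) := ⟨irreducible_X_sq_sub_C_of_not_isSquare m hnsL⟩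
  haveI := numberField_adjoinRoot m
  haveI := isQuadraticExtension_adjoinRoot m
  obtain ⟨c, hcroot, hc1'⟩ := exists_algEquiv_root_eq_neg m
  have hmδ : algebraMap L (AdjoinRoot (X ^ 2 - Polynomial.C m)) m = (AdjoinRoot.root (X ^ 2 - Polynomial.C m)) ^ 2 := (root_X_sq_sub_C_sq m).symm
  obtain ⟨w', hw', Θ, α, lam, hρρ, -, hρj, -, hjfix, hΘj, hΘΘ, hΘρ, -, hα, -, -, -, hlam, hρlam, hΘlam, -, hcoord⟩ :=
    F0P3cDyRamEigenFieldPackageTypeTwo.exists_eigenPackage (AdjoinRoot (X ^ 2 - Polynomial.C m)) w.1 c hc1' hcroot (root_X_sq_sub_C_ne_zero m) hmδ (galAdicCompletionMap (L := L) (IsCMField.complexConj L) hw) hσσ hvσ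
      hs0 hΔsm hDσ htσ hirr'
  exact exists_literalData_of_package L w hw he hD g hgU htr hdet hD0 hΔ hirr' hDσ uu hu1
      (toPlace w.1 w') (galAdicCompletionMap (L := AdjoinRoot (X ^ 2 - Polynomial.C m)) c hw') Θ hρj hΘj hρρ hΘΘ hΘρ hjfix hα hlam hρlam hΘlam hcoord

include hw in
/-- **STEP B — pull-back along the one-place frame at `A = 1`**: every `Y ∈ U(σ_w, Φ₃,w)` conjugate to the pattern of `γ_H` is `ι_w(ta)` for a MATCH `ta ∈ G_v` (★ p846897 (iii)).
[cite: Rogawski1990, §4.9 p. 54; §14.2 p. 233] -/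
theorem exists_pullback (γH : ((UnitaryGroup.cmDatum L 2 (Matrix.of fun i j : Fin 2 => if i.val + j.val + 1 = 2 then (1 : L) else 0)).Local v × (UnitaryGroup.cmDatum L 1 (Matrix.of fun i j : Fin 1 => if i.val + j.val + 1 = 1 then (1 : L) else 0)).Local v)) (Y : GL (Fin 3) (w.1.adicCompletion L))
    (hY : Y ∈ unitaryGroupOfForm (galAdicCompletionMap (L := L) (IsCMField.complexConj L) hw) (placeForm (Matrix.of fun i j : Fin 3 => if i.val + j.val + 1 = 3 then (1 : L) else 0) w.1))
    (hconj : IsConj (endoGL (((localNonsplitEquiv (IsCMField.complexConj L) (Matrix.of fun i j : Fin 2 => if i.val + j.val + 1 = 2 then (1 : L) else 0) (IsCMField.complexConj_ne_one L) w hw γH.1).val : GL (Fin 2) (w.1.adicCompletion L)), ((localNonsplitEquiv (IsCMField.complexConj L) (Matrix.of fun i j : Fin 1 => if i.val + j.val + 1 = 1 then (1 : L) else 0) (IsCMField.complexConj_ne_one L) w hw γH.2).val : GL (Fin 1) (w.1.adicCompletion L)))) Y) :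
    ∃ ta : (UnitaryGroup.cmDatum L 3 (Matrix.of fun i j : Fin 3 => if i.val + j.val + 1 = 3 then (1 : L) else 0)).Local v,
      IsLocalNormPair L (Matrix.of fun i j : Fin 3 => if i.val + j.val + 1 = 3 then (1 : L) else 0) v γH ta ∧ ((localNonsplitEquiv (IsCMField.complexConj L) (Matrix.of fun i j : Fin 3 => if i.val + j.val + 1 = 3 then (1 : L) else 0) (IsCMField.complexConj_ne_one L) w hw ta : ↥(unitaryGroupOfForm (galAdicCompletionMap (L := L) (IsCMField.complexConj L) hw) (placeForm (Matrix.of fun i j : Fin 3 => if i.val + j.val + 1 = 3 then (1 : L) else 0) w.1))) : GL (Fin 3) (w.1.adicCompletion L)) = Y := by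
  have hJ₀ : placeForm (Matrix.of fun i j : Fin 3 => if i.val + j.val + 1 = 3 then (1 : L) else 0) w.1 = (StdForm.antidiagonal 3).over (w.1.adicCompletion L) := placeForm_antidiagOne 3 w.1
  have hJ₀det : (placeForm (Matrix.of fun i j : Fin 3 => if i.val + j.val + 1 = 3 then (1 : L) else 0) w.1).det = -1 := by rw [hJ₀, F0P3cDyRamWildIntegralDress.det_antidiagonal_three]
  have hH'w : IsUnit (placeForm (Matrix.of fun i j : Fin 3 => if i.val + j.val + 1 = 3 then (1 : L) else 0) w.1) := by rw [Matrix.isUnit_iff_isUnit_det, hJ₀det]; exact isUnit_one.neg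
  have hframe : placeForm (Matrix.of fun i j : Fin 3 => if i.val + j.val + 1 = 3 then (1 : L) else 0) w.1 = (-(placeForm (Matrix.of fun i j : Fin 3 => if i.val + j.val + 1 = 3 then (1 : L) else 0) w.1).det) • formCongr (galAdicCompletionMap (L := L) (IsCMField.complexConj L) hw) (1 : GL (Fin 3) (w.1.adicCompletion L)) ((StdForm.antidiagonal 3).over (w.1.adicCompletion L)) := by
    rw [hJ₀det, neg_neg, one_smul, hJ₀]
    change _ = (((1 : GL (Fin 3) (w.1.adicCompletion L)) : Matrix (Fin 3) (Fin 3) (w.1.adicCompletion L)).map (galAdicCompletionMap (L := L) (IsCMField.complexConj L) hw))ᵀ * _ * ((1 : GL (Fin 3) (w.1.adicCompletion L)) : Matrix (Fin 3) (Fin 3) (w.1.adicCompletion L))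
    rw [Units.val_one, Matrix.map_one (galAdicCompletionMap (L := L) (IsCMField.complexConj L) hw) (map_zero _) (map_one _), Matrix.transpose_one, Matrix.one_mul, Matrix.mul_one]
  obtain ⟨e, hef, -, hmatch⟩ := exists_frame_of_eq_smul_formCongr_antidiagonal L (Matrix.of fun i j : Fin 3 => if i.val + j.val + 1 = 3 then (1 : L) else 0) w hw hH'w 1 (one_mem _) hframe
  set ta : (UnitaryGroup.cmDatum L 3 (Matrix.of fun i j : Fin 3 => if i.val + j.val + 1 = 3 then (1 : L) else 0)).Local v := e.symm ⟨Y, hY⟩ with hta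
  have het : ((e ta).val : GL (Fin 3) (w.1.adicCompletion L)) = Y := by rw [hta, ContinuousMulEquiv.apply_symm_apply]
  refine ⟨ta, (hmatch γH ta).2 ((congrArg (IsConj (endoGL (((localNonsplitEquiv (IsCMField.complexConj L) (Matrix.of fun i j : Fin 2 => if i.val + j.val + 1 = 2 then (1 : L) else 0) (IsCMField.complexConj_ne_one L) w hw γH.1).val : GL (Fin 2) (w.1.adicCompletion L)), ((localNonsplitEquiv (IsCMField.complexConj L) (Matrix.of fun i j : Fin 1 => if i.val + j.val + 1 = 1 then (1 : L) else 0) (IsCMField.complexConj_ne_one L) w hw γH.2).val : GL (Fin 1) (w.1.adicCompletion L))))) het).mpr hconj), ?_⟩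
  calc _ = (1 : GL (Fin 3) (w.1.adicCompletion L)) * ((localNonsplitEquiv (IsCMField.complexConj L) (Matrix.of fun i j : Fin 3 => if i.val + j.val + 1 = 3 then (1 : L) else 0) (IsCMField.complexConj_ne_one L) w hw ta : ↥(unitaryGroupOfForm (galAdicCompletionMap (L := L) (IsCMField.complexConj L) hw) (placeForm (Matrix.of fun i j : Fin 3 => if i.val + j.val + 1 = 3 then (1 : L) else 0) w.1))) : GL (Fin 3) (w.1.adicCompletion L)) * (1 : GL (Fin 3) (w.1.adicCompletion L))⁻¹ := by simp only [inv_one, mul_one, one_mul]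
    _ = ((e ta).val : GL (Fin 3) (w.1.adicCompletion L)) := (hef ta).symm
    _ = Y := het

include hw in
/-- **STEP C — the `κ`-sign of the pulled-back literal is `−(1, θ)_v = −1`** (★ brick 1 p857204 at `H′ = Φ₃`, `y_λ = 1`, with the `u`-eigenvector read through `ι_w(ta) = Y`).
[cite: Rogawski1990, §4.9 Prop. 4.9.1 p. 55; §4.3 (4.3.2) p. 43] [cite: LanglandsShelstad1987, §1] -/
theorem finKappaAt_eq_neg_one_of_literal (γH : ((UnitaryGroup.cmDatum L 2 (Matrix.of fun i j : Fin 2 => if i.val + j.val + 1 = 2 then (1 : L) else 0)).Local v × (UnitaryGroup.cmDatum L 1 (Matrix.of fun i j : Fin 1 => if i.val + j.val + 1 = 1 then (1 : L) else 0)).Local v))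
    (hirr : ¬ (∃ x : (w.1.adicCompletion L), (((((γH).1.val : GL (Fin 2) (UnitaryGroup.LocalRing L v)).val.map (Pi.evalRingHom (fun w' : UnitaryGroup.PlacesOver L v => w'.1.adicCompletion L) w))).charpoly).IsRoot x))
    {ta : (UnitaryGroup.cmDatum L 3 (Matrix.of fun i j : Fin 3 => if i.val + j.val + 1 = 3 then (1 : L) else 0)).Local v} (hta : IsLocalNormPair L (Matrix.of fun i j : Fin 3 => if i.val + j.val + 1 = 3 then (1 : L) else 0) v γH ta)
    {Y : GL (Fin 3) (w.1.adicCompletion L)} (hmat : ((localNonsplitEquiv (IsCMField.complexConj L) (Matrix.of fun i j : Fin 3 => if i.val + j.val + 1 = 3 then (1 : L) else 0) (IsCMField.complexConj_ne_one L) w hw ta : ↥(unitaryGroupOfForm (galAdicCompletionMap (L := L) (IsCMField.complexConj L) hw) (placeForm (Matrix.of fun i j : Fin 3 => if i.val + j.val + 1 = 3 then (1 : L) else 0) w.1))) : GL (Fin 3) (w.1.adicCompletion L)) = Y)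
    {q : Fin 3 → (w.1.adicCompletion L)} (heig : (Y : Matrix (Fin 3) (Fin 3) (w.1.adicCompletion L)).mulVec q = ((((localNonsplitEquiv (IsCMField.complexConj L) (Matrix.of fun i j : Fin 1 => if i.val + j.val + 1 = 1 then (1 : L) else 0) (IsCMField.complexConj_ne_one L) w hw γH.2).val : GL (Fin 1) (w.1.adicCompletion L)) : Matrix (Fin 1) (Fin 1) (w.1.adicCompletion L)) 0 0) • q) (hq0 : q ≠ 0)
    {a₁ : (w.1.adicCompletion L)} (hlen : (∑ i : Fin 3, ∑ k : Fin 3, (galAdicCompletionMap (L := L) (IsCMField.complexConj L) hw) (q i) * (StdForm.antidiagonal 3).over (w.1.adicCompletion L) i k * q k) = a₁)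
    (hσa₁ : (galAdicCompletionMap (L := L) (IsCMField.complexConj L) hw) a₁ = a₁) (ha₁N : ¬ ∃ t : (w.1.adicCompletion L), t * (galAdicCompletionMap (L := L) (IsCMField.complexConj L) hw) t = a₁) :
    finKappaAt L v (Matrix.of fun i j : Fin 3 => if i.val + j.val + 1 = 3 then (1 : L) else 0) γH ta = -1 := by
  have hJ₀ : placeForm (Matrix.of fun i j : Fin 3 => if i.val + j.val + 1 = 3 then (1 : L) else 0) w.1 = (StdForm.antidiagonal 3).over (w.1.adicCompletion L) := placeForm_antidiagOne 3 w.1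
  have hJ₀det : (placeForm (Matrix.of fun i j : Fin 3 => if i.val + j.val + 1 = 3 then (1 : L) else 0) w.1).det = -1 := by rw [hJ₀, F0P3cDyRamWildIntegralDress.det_antidiagonal_three]
  have hH'w : IsUnit (placeForm (Matrix.of fun i j : Fin 3 => if i.val + j.val + 1 = 3 then (1 : L) else 0) w.1) := by rw [Matrix.isUnit_iff_isUnit_det, hJ₀det]; exact isUnit_one.neg
  have hyl : toPlace v w (1 : v.adicCompletion ↥(maximalRealSubfield L)) = -(placeForm (Matrix.of fun i j : Fin 3 => if i.val + j.val + 1 = 3 then (1 : L) else 0) w.1).det := by rw [map_one, hJ₀det, neg_neg]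
  have hq₁ : ((((localNonsplitEquiv (IsCMField.complexConj L) (Matrix.of fun i j : Fin 3 => if i.val + j.val + 1 = 3 then (1 : L) else 0) (IsCMField.complexConj_ne_one L) w hw ta : ↥(unitaryGroupOfForm (galAdicCompletionMap (L := L) (IsCMField.complexConj L) hw) (placeForm (Matrix.of fun i j : Fin 3 => if i.val + j.val + 1 = 3 then (1 : L) else 0) w.1))) : GL (Fin 3) (w.1.adicCompletion L)) : GL (Fin 3) (w.1.adicCompletion L)) : Matrix (Fin 3) (Fin 3) (w.1.adicCompletion L)) *ᵥ q = finGammaTwo L v γH w • q := by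
    have h1 := congrArg (fun X : GL (Fin 3) (w.1.adicCompletion L) => (X : Matrix (Fin 3) (Fin 3) (w.1.adicCompletion L)) *ᵥ q) hmat
    exact h1.trans heig
  have hlen₁ : (∑ i : Fin 3, ∑ k : Fin 3, (galAdicCompletionMap (L := L) (IsCMField.complexConj L) hw) (q i) * placeForm (Matrix.of fun i j : Fin 3 => if i.val + j.val + 1 = 3 then (1 : L) else 0) w.1 i k * q k) = (-(placeForm (Matrix.of fun i j : Fin 3 => if i.val + j.val + 1 = 3 then (1 : L) else 0) w.1).det) * a₁ := by
    rw [hJ₀det, neg_neg, one_mul, hJ₀]; exact hlen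
  have hκ := F0P3cDyRamTypeTwoLiteralSignWild.finKappaAt_eq_neg_hilbertSymbol_of_nonNorm_length_anyPlace L (Matrix.of fun i j : Fin 3 => if i.val + j.val + 1 = 3 then (1 : L) else 0) w hw (antidiagOne_isHermitian L 3) hH'w 1 hyl γH hirr hta
    hq₁ hq0 hlen₁ hσa₁ ha₁N
  rw [hilbertSymbol_one_left] at hκ
  exact hκ

include hw in
/-- **SOCKET A — THE OPPOSITE-SIGN LITERAL OF A TYPE-(2) `γ_H` AT A WILD RAMIFIED NON-SPLIT CM PLACE, WITH ITS BLOCK LETTERS** (LH4-p14 (g4) `SOCKET-hLitA.v1` minus the two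
unit-level anisotropy clauses and the integrality of `γ₁`; `V := univ`).  STEP A ∘ STEP B ∘ STEP C.
[cite: Rogawski1990, §4.9 Prop. 4.9.1 p. 55; §3.5 Prop. 3.5.2 (c) p. 26; §4.8 Case (a) p. 53] [cite: LabesseLanglands1979, §2 pp. 8–10] [cite: LanglandsShelstad1987, §1] -/
theorem exists_oppositeLiteral_wild (he : v.asIdeal.ramificationIdx' w.1.asIdeal ≠ 1) {ϖ : w.1.adicCompletion L} {d tE : ℕ}
    (hD : Literature.NumberTheory.Automorphic.UnitaryThreeFourFrame.IsRamifiedQuadraticDatum (galAdicCompletionMap (L := L) (IsCMField.complexConj L) hw) ϖ d tE) :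
    ∃ V ∈ 𝓝 (1 : ((UnitaryGroup.cmDatum L 2 (Matrix.of fun i j : Fin 2 => if i.val + j.val + 1 = 2 then (1 : L) else 0)).Local v × (UnitaryGroup.cmDatum L 1 (Matrix.of fun i j : Fin 1 => if i.val + j.val + 1 = 1 then (1 : L) else 0)).Local v)), ∀ γH ∈ V, IsLocalGRegular L v γH →
      ¬ (∃ x : (w.1.adicCompletion L), (((((γH).1.val : GL (Fin 2) (UnitaryGroup.LocalRing L v)).val.map (Pi.evalRingHom (fun w' : UnitaryGroup.PlacesOver L v => w'.1.adicCompletion L) w))).charpoly).IsRoot x) →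
      ∃ (ta : ((UnitaryGroup.cmDatum L 3 (Matrix.of fun i j : Fin 3 => if i.val + j.val + 1 = 3 then (1 : L) else 0)).Local v)) (P₁ : GL (Fin 3) (w.1.adicCompletion L)) (dg : Fin 2 → (w.1.adicCompletion L)) (η : (w.1.adicCompletion L)) (γ₁ : GL (Fin 2) (w.1.adicCompletion L)),
        IsLocalNormPair L (Matrix.of fun i j : Fin 3 => if i.val + j.val + 1 = 3 then (1 : L) else 0) v γH ta ∧
        finKappaAt L v (Matrix.of fun i j : Fin 3 => if i.val + j.val + 1 = 3 then (1 : L) else 0) γH ta = -1 ∧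
        ((localNonsplitEquiv (IsCMField.complexConj L) (Matrix.of fun i j : Fin 3 => if i.val + j.val + 1 = 3 then (1 : L) else 0) (IsCMField.complexConj_ne_one L) w hw ta : ↥(unitaryGroupOfForm (galAdicCompletionMap (L := L) (IsCMField.complexConj L) hw) (placeForm (Matrix.of fun i j : Fin 3 => if i.val + j.val + 1 = 3 then (1 : L) else 0) w.1))) : GL (Fin 3) (w.1.adicCompletion L)) = P₁ * endoGL (γ₁, ((localNonsplitEquiv (IsCMField.complexConj L) (Matrix.of fun i j : Fin 1 => if i.val + j.val + 1 = 1 then (1 : L) else 0) (IsCMField.complexConj_ne_one L) w hw γH.2).val : GL (Fin 1) (w.1.adicCompletion L))) * P₁⁻¹ ∧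
        formCongr (galAdicCompletionMap (L := L) (IsCMField.complexConj L) hw) P₁ (placeForm (Matrix.of fun i j : Fin 3 => if i.val + j.val + 1 = 3 then (1 : L) else 0) w.1) =
          (!![(Matrix.diagonal dg) 0 0, 0, (Matrix.diagonal dg) 0 1; 0, η, 0; (Matrix.diagonal dg) 1 0, 0, (Matrix.diagonal dg) 1 1] : Matrix (Fin 3) (Fin 3) (w.1.adicCompletion L)) ∧
        (∀ i, Valued.v (dg i) = 1) ∧
        (∀ i, (galAdicCompletionMap (L := L) (IsCMField.complexConj L) hw) (dg i) = dg i) ∧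
        (galAdicCompletionMap (L := L) (IsCMField.complexConj L) hw) η = η ∧
        Valued.v η = 1 ∧
        (¬ ∃ t : (w.1.adicCompletion L), t * (galAdicCompletionMap (L := L) (IsCMField.complexConj L) hw) t = η) ∧
        γ₁ ∈ unitaryGroupOfForm (galAdicCompletionMap (L := L) (IsCMField.complexConj L) hw) (Matrix.diagonal dg) ∧
        (γ₁ : Matrix (Fin 2) (Fin 2) (w.1.adicCompletion L)).charpoly = ((((γH).1.val : GL (Fin 2) (UnitaryGroup.LocalRing L v)).val.map (Pi.evalRingHom (fun w' : UnitaryGroup.PlacesOver L v => w'.1.adicCompletion L) w))).charpoly := by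
  refine ⟨Set.univ, Filter.univ_mem, fun γH _ _ hirr => ?_⟩
  obtain ⟨P, C, d₀, d₁, a₁, -, hσd₀, hσd₁, hvd₀, hvd₁, hG₁, hσa₁, hva₁, ha₁N, hP, hYU, hconj, heig, hq0, hlen⟩ := exists_literalData L w hw he hD γH hirr
  have hJ₀ : placeForm (Matrix.of fun i j : Fin 3 => if i.val + j.val + 1 = 3 then (1 : L) else 0) w.1 = (StdForm.antidiagonal 3).over (w.1.adicCompletion L) := placeForm_antidiagOne 3 w.1
  obtain ⟨ta, hta, hmat⟩ := exists_pullback L w hw γH _ (by rw [hJ₀]; exact hYU) hconj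
  have hκ := finKappaAt_eq_neg_one_of_literal L w hw γH hirr hta hmat heig hq0 hlen hσa₁ ha₁N
  refine ⟨ta, P, ![d₀, d₁], a₁, C⁻¹ * ((localNonsplitEquiv (IsCMField.complexConj L) (Matrix.of fun i j : Fin 2 => if i.val + j.val + 1 = 2 then (1 : L) else 0) (IsCMField.complexConj_ne_one L) w hw γH.1).val : GL (Fin 2) (w.1.adicCompletion L)) * C, hta, hκ, hmat, ?_, ?_, ?_, hσa₁, hva₁, ha₁N, ?_, ?_⟩
  · rw [hJ₀, hP, endoForm_eq]
    ext i j; fin_cases i <;> fin_cases j <;> simp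
  · intro i; fin_cases i <;> simp [hvd₀, hvd₁]
  · intro i; fin_cases i <;> simp [hσd₀, hσd₁]
  · rw [← diagTwo_eq_diagonal]; exact hG₁
  · rw [Units.val_mul, Units.val_mul, Matrix.coe_units_inv]
    exact Matrix.charpoly_units_conj' C _

end CM

end Summit.HodgeConjecture.HodgeConjecture.Cruxes.H413.F0P3cDyRamTypeTwoOppositeLiteralWild

end
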